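import Literature.NumberTheory.GaloisCohomology.Howard2004.SelmerTriples
import Literature.RingTheory.Idempotents.AdicIdempotentLifting
import HarnessLib

/-!
# Howard 2004, Def. 1.2.1 — when the typed `I_ℓ = frobIdeal` has its defining property

B. Howard, *The Heegner point Kolyvagin system*, Compos. Math. 140 (2004), Def. 1.2.1
(arXiv:1202.6340, Def. 2.2.1, p. 6, L63–68): «define `I_ℓ` to be the smallest ideal of `R`
containing `ℓ+1` for which `Frob_λ` acts trivially on `T/I_ℓ T`» and
«`𝓛_k = {ℓ ∈ 𝓛₀ | I_ℓ ⊂ p^k ℤ_p}`».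

The tree types `I_ℓ` as `frobIdeal (R := R) ρ v := sInf S_v` with
`S_v = {I | ℓ+1 ∈ I ∧ ∀ Frob_v σ, ∀ m, ρ σ m - m ∈ I • ⊤}` (`SelmerTriples.lean`, §D).  The set
`S_v` is an up-set of ideals (`mem_frobIdealSet_of_le`), but an infimum of members of `S_v` need not
lie in `S_v`: Howard's «smallest ideal» exists because his `T` is free over `R` (hypothesis H.0),
and then `⋂_α (I_α • T) = (⋂_α I_α) • T`.  This file records, sorry-free:

* (private helpers) `iInf_ideal_smul_top_eq_of_free`, `sInf_ideal_smul_top_eq_of_free` — for a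
  free module, `(⨅ I_i) • ⊤ = ⨅ (I_i • ⊤)` (any index family); `exists_least_of_isDiscreteValuationRing`
  — over a DVR a nonempty set of ideals above a fixed `x ≠ 0` has a least element;
* `frobIdeal_mem_of_exists_least` — if `S_v` has a least element, `frobIdeal` has the defining
  property (`ℓ+1 ∈ I_ℓ` and `Frob_v ≡ 1 mod I_ℓ • ⊤`);
* `frobIdeal_mem_of_free` / `frobIdeal_mem_of_h0` — the defining property when `M` is free over `R`
  (Howard's H.0; by name from the tree's `H0 R M`, the head of `SatisfiesH.h0`);
* `frobIdeal_mem_of_isDiscreteValuationRing` (`_of_charZero`) — the defining property for ANY `M` when `R` is a DVR and `ℓ+1 ≠ 0` in `R` (the ideals above `ℓ+1`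
  form a finite chain), e.g. `R = ℤ_p` or `R = Λ/(q_m)` acting on non-free finite levels;
* `frobIdeal_le_iff_of_mem`, `mem_kolyvaginPrimes_iff_of_mem` (+ `_of_free`, `_of_h0`,
  `_of_isDiscreteValuationRing` instances) — under the defining property, `I_ℓ ≤ I ↔ I ∈ S_v`, so
  `v ∈ 𝓛_k ↔ v ∈ 𝓛₀ ∧ ℓ+1 ∈ p^k R ∧ Frob_v ≡ 1 (mod p^k M)` (Howard's condition unpacked);
* `frobIdeal_le_of_mem`, `mem_kolyvaginPrimes_of_forall` — the unpacked condition ALWAYS implies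
  the typed one (no hypothesis on `R`, `M`).

**Caveat recorded for consumers (not a theorem of this file).**  Without freeness / the chain
property the converse fails.  Example: `R = Λ = ℤ_p⟦T⟧` acting on a finite level
`N = E[p^k] ⊗ Λ/J`, `J = (p^k, ω_n)` (or any `J ⊆ 𝔪_Λ` containing a distinguished polynomial);
`N` is free over `Λ/J`, so `I ∈ S_v ↔ ℓ+1 ∈ I ∧ 𝔠 ≤ I + J` with `𝔠 = (p^a) + J`, `p^a` the
content of `Frob_v - 1`.  If `a ≥ 1`, every `I_g = (ℓ+1, p^a + ω_n g)`, `g ∈ Λ`, lies in `S_v`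
and `⋂_j (p^v, p^a + ω_n T^j) = (p^v)` (`v = v_p(ℓ+1)`; reduce mod `p`, where
`⋂_j T^{p^n + j} 𝔽_p⟦T⟧ = 0`, divide by `p`, induct), so `sInf S_v = (ℓ+1)Λ ∉ S_v`:
`Frob_v` does not act trivially on `N / (sInf S_v) N`, and the typed `𝓛_k` at `R = Λ` contains
every `λ ∈ 𝓛₀` with `p^k ∣ ℓ+1` and `Frob_λ ≡ 1 (mod p)`, strictly more than Howard's
`{p^k ∣ ℓ+1 ∧ Frob_λ ≡ 1 (mod p^k)}`.  Remedy: compute `frobIdeal` / `kolyvaginPrimes` /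
`levelIdeal` with `R :=` the ring over which the level is free (then `frobIdeal_mem_of_free`
applies), or use the unpacked membership (`mem_kolyvaginPrimes_iff_of_mem`).

## Main statements

* `frobIdeal_mem_of_free`, `frobIdeal_mem_of_isDiscreteValuationRing`,
  `mem_kolyvaginPrimes_iff_of_free`, `mem_kolyvaginPrimes_iff_of_isDiscreteValuationRing`.
-/

set_option autoImplicit false

open Function NumberField IsDedekindDomain Field
open scoped NumberField ContRepresentation Classical

namespace Literature.NumberTheory.GaloisCohomology.Howard2004

open Literature.NumberTheory.GaloisRepresentations
open Literature.NumberTheory.GaloisRepresentations.DiscreteGaloisModule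

/-! ## 1. Module algebra: infima of ideals against a free module; least elements over a DVR -/

section Algebra

variable {A : Type*} [CommRing A] {N : Type*} [AddCommGroup N] [Module A N]

/-- For a free module `N`, `(⨅ i, I i) • N = ⨅ i, (I i • N)`: an element lies in `I • ⊤` iff all
its coordinates in a basis lie in `I`. [folklore] (private helper) -/
private theorem iInf_ideal_smul_top_eq_of_free [Module.Free A N] {ι : Sort*} (I : ι → Ideal A) :
    ((⨅ i, I i) • (⊤ : Submodule A N) : Submodule A N) = ⨅ i, (I i • (⊤ : Submodule A N)) := by
  apply le_antisymm
  · exact le_iInf fun i => Submodule.smul_mono_left (iInf_le I i)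
  · intro x hx
    rw [Literature.RingTheory.Idempotents.mem_smul_top_iff_forall_repr_mem
      (Module.Free.chooseBasis A N)]
    intro j
    rw [Submodule.mem_iInf]
    intro i
    exact (Literature.RingTheory.Idempotents.mem_smul_top_iff_forall_repr_mem
      (Module.Free.chooseBasis A N) (I i) x).mp ((Submodule.mem_iInf _).mp hx i) j

/-- For a free module `N` and a set `S` of ideals, `(sInf S) • N = ⨅ I ∈ S, I • N`. [folklore] (private helper) -/
private theorem sInf_ideal_smul_top_eq_of_free [Module.Free A N] (S : Set (Ideal A)) :
    ((sInf S) • (⊤ : Submodule A N) : Submodule A N) = ⨅ I ∈ S, (I • (⊤ : Submodule A N)) := by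
  rw [sInf_eq_iInf, iInf_ideal_smul_top_eq_of_free]
  exact iInf_congr fun I => iInf_ideal_smul_top_eq_of_free _

/-- In a discrete valuation ring, a nonempty set of ideals all containing a fixed non-zero element
`x` has a LEAST element: every such ideal is `(ϖ^n)` with `n ≤ v(x)`, and the one with the largest
exponent is contained in all the others. [folklore] (private helper) -/
private theorem exists_least_of_isDiscreteValuationRing {R : Type*} [CommRing R] [IsDomain R]
    [IsDiscreteValuationRing R] {x : R} (hx : x ≠ 0) {S : Set (Ideal R)} (hS : S.Nonempty)
    (hxS : ∀ I ∈ S, x ∈ I) : ∃ I₀ ∈ S, ∀ I ∈ S, I₀ ≤ I := by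
  classical
  obtain ⟨ϖ, hϖ⟩ := IsDiscreteValuationRing.exists_irreducible R
  obtain ⟨n₀, u, hxu⟩ := IsDiscreteValuationRing.eq_unit_mul_pow_irreducible hx hϖ
  -- every `I ∈ S` is `(ϖ ^ n)` with `n ≤ n₀`
  have key : ∀ I ∈ S, ∃ n, n ≤ n₀ ∧ I = Ideal.span {ϖ ^ n} := by
    intro I hI
    have hI0 : I ≠ ⊥ := by
      intro h
      have hx' := hxS I hI
      rw [h, Ideal.mem_bot] at hx'
      exact hx hx'
    obtain ⟨n, hn⟩ := IsDiscreteValuationRing.ideal_eq_span_pow_irreducible hI0 hϖ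
    refine ⟨n, ?_, hn⟩
    have hdvd : ϖ ^ n ∣ x := Ideal.mem_span_singleton.mp (hn ▸ hxS I hI)
    rw [hxu, Units.dvd_mul_left] at hdvd
    exact (pow_dvd_pow_iff hϖ.ne_zero hϖ.not_isUnit).mp hdvd
  obtain ⟨I₁, hI₁⟩ := hS
  obtain ⟨n₁, hn₁, hI₁eq⟩ := key I₁ hI₁
  have hP₁ : (fun n => Ideal.span {ϖ ^ n} ∈ S) n₁ := by simpa only [← hI₁eq] using hI₁
  refine ⟨Ideal.span {ϖ ^ Nat.findGreatest (fun n => Ideal.span {ϖ ^ n} ∈ S) n₀},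
    Nat.findGreatest_spec (P := fun n => Ideal.span {ϖ ^ n} ∈ S) hn₁ hP₁, fun I hI => ?_⟩
  obtain ⟨n, hn, rfl⟩ := key I hI
  exact Ideal.span_singleton_le_span_singleton.mpr
    (pow_dvd_pow ϖ (Nat.le_findGreatest (P := fun n => Ideal.span {ϖ ^ n} ∈ S) hn hI))

end Algebra

/-! ## 2. The defining property of `frobIdeal` (Howard's `I_ℓ`) -/

section Frob

variable {K : Type} [Field K] [NumberField K] {M : Type} [AddCommGroup M] [TopologicalSpace M]
  [DiscreteTopology M]
variable {R : Type} [CommRing R] [Module R M]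

/-- The defining set `S_v` of `I_ℓ` is an up-set: if `ℓ+1 ∈ I`, `Frob_v ≡ 1 (mod I•T)` and
`I ≤ J`, then the same holds for `J`. [cite: Howard2004HeegnerKolyvagin, Def. 1.2.1 (arXiv p. 6, L63–66)] -/
theorem mem_frobIdealSet_of_le (ρ : DiscreteGaloisModule K M) (v : HeightOneSpectrum (𝓞 K))
    {I J : Ideal R}
    (hI : ((residueChar v + 1 : ℕ) : R) ∈ I ∧
      ∀ σ : absoluteGaloisGroup K, IsArithFrobAtPlace K v σ →
        ∀ m : M, ρ σ m - m ∈ (I • (⊤ : Submodule R M) : Submodule R M))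
    (hIJ : I ≤ J) :
    ((residueChar v + 1 : ℕ) : R) ∈ J ∧
      ∀ σ : absoluteGaloisGroup K, IsArithFrobAtPlace K v σ →
        ∀ m : M, ρ σ m - m ∈ (J • (⊤ : Submodule R M) : Submodule R M) :=
  ⟨hIJ hI.1, fun σ hσ m => Submodule.smul_mono_left hIJ (hI.2 σ hσ m)⟩

/-- `R` itself lies in the defining set `S_v` of `I_ℓ` (so `S_v` is nonempty).
[cite: Howard2004HeegnerKolyvagin, Def. 1.2.1 (arXiv p. 6, L63–66)] -/
theorem top_mem_frobIdealSet (ρ : DiscreteGaloisModule K M) (v : HeightOneSpectrum (𝓞 K)) :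
    ((residueChar v + 1 : ℕ) : R) ∈ (⊤ : Ideal R) ∧
      ∀ σ : absoluteGaloisGroup K, IsArithFrobAtPlace K v σ →
        ∀ m : M, ρ σ m - m ∈ ((⊤ : Ideal R) • (⊤ : Submodule R M) : Submodule R M) :=
  ⟨Submodule.mem_top, fun σ _ m => by
    rw [Submodule.top_smul]
    exact Submodule.mem_top⟩

/-- `I_ℓ ≤ I` for every ideal `I ∋ ℓ+1` modulo which `Frob_v` acts trivially (ALWAYS; this is
`sInf_le`).  [cite: Howard2004HeegnerKolyvagin, Def. 1.2.1 (arXiv p. 6, L63–66)] -/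
theorem frobIdeal_le_of_mem (ρ : DiscreteGaloisModule K M) (v : HeightOneSpectrum (𝓞 K))
    {I : Ideal R}
    (hI : ((residueChar v + 1 : ℕ) : R) ∈ I ∧
      ∀ σ : absoluteGaloisGroup K, IsArithFrobAtPlace K v σ →
        ∀ m : M, ρ σ m - m ∈ (I • (⊤ : Submodule R M) : Submodule R M)) :
    frobIdeal (R := R) ρ v ≤ I := by
  unfold frobIdeal
  exact sInf_le hI

/-- Howard's `𝓛_k`-condition unpacked ALWAYS implies typed membership: if `v ∈ 𝓛₀`,
`ℓ+1 ∈ p^k R` and `Frob_v ≡ 1 (mod p^k M)`, then `v ∈ kolyvaginPrimes p ρ k` (no hypothesis on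
`R` or `M`).  [cite: Howard2004HeegnerKolyvagin, Def. 1.2.1 (arXiv p. 6, L67–68)] -/
theorem mem_kolyvaginPrimes_of_forall (p : ℕ) (ρ : DiscreteGaloisModule K M) (k : ℕ)
    {v : HeightOneSpectrum (𝓞 K)} (hv : v ∈ degreeTwoPrimes p ρ)
    (h₁ : ((residueChar v + 1 : ℕ) : R) ∈ Ideal.span {((p : ℕ) : R) ^ k})
    (h₂ : ∀ σ : absoluteGaloisGroup K, IsArithFrobAtPlace K v σ →
      ∀ m : M, ρ σ m - m ∈
        ((Ideal.span {((p : ℕ) : R) ^ k}) • (⊤ : Submodule R M) : Submodule R M)) :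
    v ∈ kolyvaginPrimes (R := R) p ρ k :=
  ⟨hv, frobIdeal_le_of_mem ρ v ⟨h₁, h₂⟩⟩

/-- If the defining set `S_v` has a least element, then `I_ℓ = frobIdeal` has the defining
property: `ℓ+1 ∈ I_ℓ` and `Frob_v` acts trivially on `T/I_ℓ T`.
[cite: Howard2004HeegnerKolyvagin, Def. 1.2.1 (arXiv p. 6, L63–66)] -/
theorem frobIdeal_mem_of_exists_least (ρ : DiscreteGaloisModule K M) (v : HeightOneSpectrum (𝓞 K))
    (h : ∃ I₀ : Ideal R, (((residueChar v + 1 : ℕ) : R) ∈ I₀ ∧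
      ∀ σ : absoluteGaloisGroup K, IsArithFrobAtPlace K v σ →
        ∀ m : M, ρ σ m - m ∈ (I₀ • (⊤ : Submodule R M) : Submodule R M)) ∧
      ∀ I : Ideal R, (((residueChar v + 1 : ℕ) : R) ∈ I ∧
        ∀ σ : absoluteGaloisGroup K, IsArithFrobAtPlace K v σ →
          ∀ m : M, ρ σ m - m ∈ (I • (⊤ : Submodule R M) : Submodule R M)) → I₀ ≤ I) :
    ((residueChar v + 1 : ℕ) : R) ∈ frobIdeal (R := R) ρ v ∧
      ∀ σ : absoluteGaloisGroup K, IsArithFrobAtPlace K v σ →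
        ∀ m : M, ρ σ m - m ∈ (frobIdeal (R := R) ρ v • (⊤ : Submodule R M) : Submodule R M) := by
  obtain ⟨I₀, hI₀, hle⟩ := h
  have heq : frobIdeal (R := R) ρ v = I₀ := by
    unfold frobIdeal
    exact le_antisymm (sInf_le hI₀) (le_sInf fun I hI => hle I hI)
  rw [heq]
  exact hI₀

/-- **H.0 case.** If `M` is free over `R` (Howard's hypothesis H.0 on `T`), then `I_ℓ = frobIdeal`
has the defining property: `ℓ+1 ∈ I_ℓ` and `Frob_v` acts trivially on `T/I_ℓ T` — because
`⋂_{I ∈ S_v} I•T = (⋂_{I ∈ S_v} I)•T` for free `T`.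
[cite: Howard2004HeegnerKolyvagin, Def. 1.2.1 + H.0 (arXiv p. 6, L63–66; p. 7)] -/
theorem frobIdeal_mem_of_free [Module.Free R M] (ρ : DiscreteGaloisModule K M)
    (v : HeightOneSpectrum (𝓞 K)) :
    ((residueChar v + 1 : ℕ) : R) ∈ frobIdeal (R := R) ρ v ∧
      ∀ σ : absoluteGaloisGroup K, IsArithFrobAtPlace K v σ →
        ∀ m : M, ρ σ m - m ∈ (frobIdeal (R := R) ρ v • (⊤ : Submodule R M) : Submodule R M) := by
  refine ⟨natCast_residueChar_add_one_mem_frobIdeal ρ v, fun σ hσ m => ?_⟩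
  rw [frobIdeal, sInf_ideal_smul_top_eq_of_free]
  simp only [Submodule.mem_iInf]
  intro I hI
  exact hI.2 σ hσ m

/-- **H.0 by name.** Under the tree's `H0 R M` (`= Module.Free R M ∧ finrank R M = 2`, the
head of `SatisfiesH.h0`), `I_ℓ = frobIdeal` has the defining property.
[cite: Howard2004HeegnerKolyvagin, Def. 1.2.1 + H.0 (arXiv p. 6, L63–66; p. 7)] -/
theorem frobIdeal_mem_of_h0 (h0 : H0 R M) (ρ : DiscreteGaloisModule K M)
    (v : HeightOneSpectrum (𝓞 K)) :
    ((residueChar v + 1 : ℕ) : R) ∈ frobIdeal (R := R) ρ v ∧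
      ∀ σ : absoluteGaloisGroup K, IsArithFrobAtPlace K v σ →
        ∀ m : M, ρ σ m - m ∈ (frobIdeal (R := R) ρ v • (⊤ : Submodule R M) : Submodule R M) := by
  haveI := h0.1
  exact frobIdeal_mem_of_free ρ v

/-- **DVR case, any `M`.** If `R` is a discrete valuation ring in which `ℓ+1 ≠ 0` (e.g. `ℤ_p`,
`𝒪`, `Λ/(q)` for a distinguished `q`), then `I_ℓ = frobIdeal` has the defining property for EVERY
`R`-module `M` (free or not, e.g. a finite level `T/p^k T`): the ideals above `ℓ+1` form a finite
chain, so `S_v` has a least element.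
[cite: Howard2004HeegnerKolyvagin, Def. 1.2.1 (arXiv p. 6, L63–66)] -/
theorem frobIdeal_mem_of_isDiscreteValuationRing [IsDomain R] [IsDiscreteValuationRing R]
    (ρ : DiscreteGaloisModule K M) (v : HeightOneSpectrum (𝓞 K))
    (hℓ : ((residueChar v + 1 : ℕ) : R) ≠ 0) :
    ((residueChar v + 1 : ℕ) : R) ∈ frobIdeal (R := R) ρ v ∧
      ∀ σ : absoluteGaloisGroup K, IsArithFrobAtPlace K v σ →
        ∀ m : M, ρ σ m - m ∈ (frobIdeal (R := R) ρ v • (⊤ : Submodule R M) : Submodule R M) := by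
  apply frobIdeal_mem_of_exists_least
  obtain ⟨I₀, hI₀, hle⟩ := exists_least_of_isDiscreteValuationRing hℓ
    (S := {I : Ideal R | ((residueChar v + 1 : ℕ) : R) ∈ I ∧
      ∀ σ : absoluteGaloisGroup K, IsArithFrobAtPlace K v σ →
        ∀ m : M, ρ σ m - m ∈ (I • (⊤ : Submodule R M) : Submodule R M)})
    ⟨⊤, top_mem_frobIdealSet ρ v⟩ (fun I hI => hI.1)
  exact ⟨I₀, hI₀, hle⟩

/-- DVR of characteristic zero (e.g. `ℤ_p`, `Λ/(q)`): `ℓ+1 ≠ 0` is automatic.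
[cite: Howard2004HeegnerKolyvagin, Def. 1.2.1 (arXiv p. 6, L63–66)] -/
theorem frobIdeal_mem_of_isDiscreteValuationRing_of_charZero [IsDomain R]
    [IsDiscreteValuationRing R] [CharZero R]
    (ρ : DiscreteGaloisModule K M) (v : HeightOneSpectrum (𝓞 K)) :
    ((residueChar v + 1 : ℕ) : R) ∈ frobIdeal (R := R) ρ v ∧
      ∀ σ : absoluteGaloisGroup K, IsArithFrobAtPlace K v σ →
        ∀ m : M, ρ σ m - m ∈ (frobIdeal (R := R) ρ v • (⊤ : Submodule R M) : Submodule R M) :=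
  frobIdeal_mem_of_isDiscreteValuationRing ρ v (Nat.cast_ne_zero.mpr (Nat.succ_ne_zero _))

/-! ## 3. Consequences: `I_ℓ ≤ I ↔ I ∈ S_v`, and `𝓛_k` unpacked -/

/-- Under the defining property of `I_ℓ`: `I_ℓ ≤ I` iff `ℓ+1 ∈ I` and `Frob_v ≡ 1 (mod I•T)`.
[cite: Howard2004HeegnerKolyvagin, Def. 1.2.1 (arXiv p. 6, L63–66)] -/
theorem frobIdeal_le_iff_of_mem (ρ : DiscreteGaloisModule K M) (v : HeightOneSpectrum (𝓞 K))
    (h : ((residueChar v + 1 : ℕ) : R) ∈ frobIdeal (R := R) ρ v ∧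
      ∀ σ : absoluteGaloisGroup K, IsArithFrobAtPlace K v σ →
        ∀ m : M, ρ σ m - m ∈ (frobIdeal (R := R) ρ v • (⊤ : Submodule R M) : Submodule R M))
    (I : Ideal R) :
    frobIdeal (R := R) ρ v ≤ I ↔
      (((residueChar v + 1 : ℕ) : R) ∈ I ∧
        ∀ σ : absoluteGaloisGroup K, IsArithFrobAtPlace K v σ →
          ∀ m : M, ρ σ m - m ∈ (I • (⊤ : Submodule R M) : Submodule R M)) :=
  ⟨fun hle => mem_frobIdealSet_of_le ρ v h hle, fun hI => frobIdeal_le_of_mem ρ v hI⟩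

/-- Under the defining property of `I_ℓ`, Howard's `𝓛_k` unpacked:
`v ∈ 𝓛_k ↔ v ∈ 𝓛₀ ∧ ℓ+1 ∈ p^k R ∧ Frob_v ≡ 1 (mod p^k T)`.
[cite: Howard2004HeegnerKolyvagin, Def. 1.2.1 (arXiv p. 6, L67–68)] -/
theorem mem_kolyvaginPrimes_iff_of_mem (p : ℕ) (ρ : DiscreteGaloisModule K M) (k : ℕ)
    (v : HeightOneSpectrum (𝓞 K))
    (h : ((residueChar v + 1 : ℕ) : R) ∈ frobIdeal (R := R) ρ v ∧
      ∀ σ : absoluteGaloisGroup K, IsArithFrobAtPlace K v σ →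
        ∀ m : M, ρ σ m - m ∈ (frobIdeal (R := R) ρ v • (⊤ : Submodule R M) : Submodule R M)) :
    v ∈ kolyvaginPrimes (R := R) p ρ k ↔
      (v ∈ degreeTwoPrimes p ρ ∧ ((residueChar v + 1 : ℕ) : R) ∈ Ideal.span {((p : ℕ) : R) ^ k} ∧
        ∀ σ : absoluteGaloisGroup K, IsArithFrobAtPlace K v σ →
          ∀ m : M, ρ σ m - m ∈
            ((Ideal.span {((p : ℕ) : R) ^ k}) • (⊤ : Submodule R M) : Submodule R M)) := by
  show (v ∈ degreeTwoPrimes p ρ ∧ frobIdeal (R := R) ρ v ≤ _) ↔ _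
  rw [frobIdeal_le_iff_of_mem ρ v h]

/-- **H.0 case:** `I_ℓ ≤ I ↔ (ℓ+1 ∈ I ∧ Frob_v ≡ 1 (mod I•T))` for `T` free over `R`.
[cite: Howard2004HeegnerKolyvagin, Def. 1.2.1 + H.0 (arXiv p. 6, L63–66; p. 7)] -/
theorem frobIdeal_le_iff_of_free [Module.Free R M] (ρ : DiscreteGaloisModule K M)
    (v : HeightOneSpectrum (𝓞 K)) (I : Ideal R) :
    frobIdeal (R := R) ρ v ≤ I ↔
      (((residueChar v + 1 : ℕ) : R) ∈ I ∧
        ∀ σ : absoluteGaloisGroup K, IsArithFrobAtPlace K v σ →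
          ∀ m : M, ρ σ m - m ∈ (I • (⊤ : Submodule R M) : Submodule R M)) :=
  frobIdeal_le_iff_of_mem ρ v (frobIdeal_mem_of_free ρ v) I

/-- **H.0 case:** `v ∈ 𝓛_k ↔ v ∈ 𝓛₀ ∧ ℓ+1 ∈ p^k R ∧ Frob_v ≡ 1 (mod p^k T)` for `T` free
over `R`. [cite: Howard2004HeegnerKolyvagin, Def. 1.2.1 + H.0 (arXiv p. 6, L67–68; p. 7)] -/
theorem mem_kolyvaginPrimes_iff_of_free [Module.Free R M] (p : ℕ) (ρ : DiscreteGaloisModule K M)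
    (k : ℕ) (v : HeightOneSpectrum (𝓞 K)) :
    v ∈ kolyvaginPrimes (R := R) p ρ k ↔
      (v ∈ degreeTwoPrimes p ρ ∧ ((residueChar v + 1 : ℕ) : R) ∈ Ideal.span {((p : ℕ) : R) ^ k} ∧
        ∀ σ : absoluteGaloisGroup K, IsArithFrobAtPlace K v σ →
          ∀ m : M, ρ σ m - m ∈
            ((Ideal.span {((p : ℕ) : R) ^ k}) • (⊤ : Submodule R M) : Submodule R M)) :=
  mem_kolyvaginPrimes_iff_of_mem p ρ k v (frobIdeal_mem_of_free ρ v)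

/-- **H.0 by name:** `v ∈ 𝓛_k ↔ v ∈ 𝓛₀ ∧ ℓ+1 ∈ p^k R ∧ Frob_v ≡ 1 (mod p^k T)` under the
tree's `H0 R M`. [cite: Howard2004HeegnerKolyvagin, Def. 1.2.1 + H.0 (arXiv p. 6, L67–68; p. 7)] -/
theorem mem_kolyvaginPrimes_iff_of_h0 (h0 : H0 R M) (p : ℕ) (ρ : DiscreteGaloisModule K M)
    (k : ℕ) (v : HeightOneSpectrum (𝓞 K)) :
    v ∈ kolyvaginPrimes (R := R) p ρ k ↔
      (v ∈ degreeTwoPrimes p ρ ∧ ((residueChar v + 1 : ℕ) : R) ∈ Ideal.span {((p : ℕ) : R) ^ k} ∧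
        ∀ σ : absoluteGaloisGroup K, IsArithFrobAtPlace K v σ →
          ∀ m : M, ρ σ m - m ∈
            ((Ideal.span {((p : ℕ) : R) ^ k}) • (⊤ : Submodule R M) : Submodule R M)) :=
  mem_kolyvaginPrimes_iff_of_mem p ρ k v (frobIdeal_mem_of_h0 h0 ρ v)

/-- **DVR case, any `T`:** `I_ℓ ≤ I ↔ (ℓ+1 ∈ I ∧ Frob_v ≡ 1 (mod I•T))`.
[cite: Howard2004HeegnerKolyvagin, Def. 1.2.1 (arXiv p. 6, L63–66)] -/
theorem frobIdeal_le_iff_of_isDiscreteValuationRing [IsDomain R] [IsDiscreteValuationRing R]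
    (ρ : DiscreteGaloisModule K M) (v : HeightOneSpectrum (𝓞 K))
    (hℓ : ((residueChar v + 1 : ℕ) : R) ≠ 0) (I : Ideal R) :
    frobIdeal (R := R) ρ v ≤ I ↔
      (((residueChar v + 1 : ℕ) : R) ∈ I ∧
        ∀ σ : absoluteGaloisGroup K, IsArithFrobAtPlace K v σ →
          ∀ m : M, ρ σ m - m ∈ (I • (⊤ : Submodule R M) : Submodule R M)) :=
  frobIdeal_le_iff_of_mem ρ v (frobIdeal_mem_of_isDiscreteValuationRing ρ v hℓ) I

/-- **DVR case, any `T`:** `v ∈ 𝓛_k ↔ v ∈ 𝓛₀ ∧ ℓ+1 ∈ p^k R ∧ Frob_v ≡ 1 (mod p^k T)`.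
[cite: Howard2004HeegnerKolyvagin, Def. 1.2.1 (arXiv p. 6, L67–68)] -/
theorem mem_kolyvaginPrimes_iff_of_isDiscreteValuationRing [IsDomain R]
    [IsDiscreteValuationRing R] (p : ℕ) (ρ : DiscreteGaloisModule K M) (k : ℕ)
    (v : HeightOneSpectrum (𝓞 K)) (hℓ : ((residueChar v + 1 : ℕ) : R) ≠ 0) :
    v ∈ kolyvaginPrimes (R := R) p ρ k ↔
      (v ∈ degreeTwoPrimes p ρ ∧ ((residueChar v + 1 : ℕ) : R) ∈ Ideal.span {((p : ℕ) : R) ^ k} ∧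
        ∀ σ : absoluteGaloisGroup K, IsArithFrobAtPlace K v σ →
          ∀ m : M, ρ σ m - m ∈
            ((Ideal.span {((p : ℕ) : R) ^ k}) • (⊤ : Submodule R M) : Submodule R M)) :=
  mem_kolyvaginPrimes_iff_of_mem p ρ k v (frobIdeal_mem_of_isDiscreteValuationRing ρ v hℓ)

end Frob

end Literature.NumberTheory.GaloisCohomology.Howard2004
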